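import Literature.Analysis.FluidPDE.NewtonPotentialHolder
import HarnessLib

/-!
# Far-field expansion of the Newtonian potential of a decaying density on `ℝ³` (zeroth order)

Analysis/FluidPDE support file (theorems only) serving the asymptotic half of Schoen–Yau's
Lemma 3.2 (Comm. Math. Phys. 65 (1979), pp. 66–70): the expansion `v = A/r + ω`,
`ω = O(r⁻²)`, of a decaying solution of `Δv − fv = h` on an asymptotically flat end is read off
a Green-function representation ((3.12)–(3.18)), whose leading term is the Newtonian potential of
the (decaying) right-hand side. In the tree's notation (`newtonKernel z = Γ(z) = −1/(4π|z|)`,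
`NewtonKernel.lean`) this file proves the **monopole expansion of the Newtonian potential**
`u(x) = ∫ Γ(x − y) F(y) dy` of a density with finite first moment and quartic decay:

* `abs_newtonKernel_sub_sub_newtonKernel_le` — `|Γ(x − y) − Γ(x)| ≤ ‖y‖/(π‖x‖²)` for
  `‖y‖ ≤ ‖x‖/2` (mean value inequality on `B̄(x, ‖x‖/2)`, `‖DΓ(z)‖ = (4π|z|²)⁻¹`);
* `integral_indicator_ball_abs_newtonKernel` — `∫_{B(x,r)} |Γ(x − y)| dy = 3|B₁| r²/(8π)`
  (translation and the radial integral `∫_{B(0,r)} |z|⁻¹`, `integral_ball_norm_rpow_neg`);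
* `integrable_newtonKernel_sub_mul_of_decay` — `y ↦ Γ(x − y) F(y)` is integrable for `‖x‖ ≥ 4`
  when `F ∈ L¹` and `‖y‖⁴|F(y)| ≤ C₄`;
* `abs_integral_newtonKernel_mul_sub_le` — **`|u(x) − Q Γ(x)| ≤ K ‖x‖⁻²` for `‖x‖ ≥ 4`**,
  `Q = ∫ F`, `K = (7/(2π)) ∫ ‖y‖|F(y)| dy + (3|B₁|/(8π)) C₄`, under `F ∈ L¹`,
  `∫ ‖y‖ |F| < ∞`, `‖y‖⁴ |F| ≤ C₄` (near region `‖y‖ ≤ ‖x‖/2` by the increment bound; far region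
  by `|F| ≤ 16 C₄‖x‖⁻⁴` on `B(x, ‖x‖/4)` and `|Γ(x − y)| ≤ (π‖x‖)⁻¹` off it, with
  `∫_{‖y‖>‖x‖/2} |F| ≤ 2‖x‖⁻¹ ∫ ‖y‖|F|`).

The finite first moment is essential: for `F = O(r⁻⁴)` alone the remainder is `O(r⁻² log r)` in
general (the dipole moment `∫_{|y|<ρ} F(y) y dy` may grow like `log ρ`). No definitions, no named
facts.

## References

* R. Schoen, S.-T. Yau, *On the proof of the positive mass conjecture in general relativity*,
  Comm. Math. Phys. 65 (1979) 45–76, proof of Lemma 3.2, (3.12)–(3.18) (pp. 67–69).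
  [SchoenYauPMT1979]
* D. Gilbarg, N. S. Trudinger, *Elliptic Partial Differential Equations of Second Order*
  (2001), (2.12)–(2.14) (the Newtonian kernel and its derivatives). [GilbargTrudinger2001]
-/

noncomputable section

open MeasureTheory Set Filter Metric Topology Function Real

namespace Literature.Analysis.FluidPDE

/-! ### The increment of the Newtonian kernel far from the pole -/

/-- Points of the closed ball `B̄(x, ‖x‖/2)` have norm at least `‖x‖/2`. [folklore] -/
theorem half_norm_le_of_mem_closedBall {x z : EuclideanSpace ℝ (Fin 3)} (hz : z ∈ closedBall x (‖x‖ / 2)) :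
    ‖x‖ / 2 ≤ ‖z‖ := by
  rw [mem_closedBall, dist_eq_norm] at hz
  have h := norm_sub_norm_le x z
  have h' : ‖x - z‖ = ‖z - x‖ := norm_sub_rev x z
  linarith

/-- **Mean value bound for the Newtonian kernel**: for `‖y‖ ≤ ‖x‖/2`, `x ≠ 0`,
`|Γ(x − y) − Γ(x)| ≤ ‖y‖ / (π ‖x‖²)` (`‖DΓ(z)‖ = (4π‖z‖²)⁻¹ ≤ (π‖x‖²)⁻¹` on the convex set
`B̄(x, ‖x‖/2)`, which avoids the origin). Gilbarg–Trudinger (2.13)–(2.14).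
[cite: GilbargTrudinger2001, (2.13)–(2.14)] -/
theorem abs_newtonKernel_sub_sub_newtonKernel_le {x y : EuclideanSpace ℝ (Fin 3)} (hx : x ≠ 0) (hy : ‖y‖ ≤ ‖x‖ / 2) :
    |newtonKernel (x - y) - newtonKernel x| ≤ ‖y‖ / (π * ‖x‖ ^ 2) := by
  have hx0 : 0 < ‖x‖ := norm_pos_iff.2 hx
  have hz0 : ∀ z ∈ closedBall x (‖x‖ / 2), z ≠ 0 := fun z hz h0 ↦ by
    have := half_norm_le_of_mem_closedBall hz
    rw [h0, norm_zero] at this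
    linarith
  have hdiff : ∀ z ∈ closedBall x (‖x‖ / 2), DifferentiableAt ℝ newtonKernel z := fun z hz ↦
    (contDiffAt_newtonKernel (hz0 z hz) (n := 1)).differentiableAt one_ne_zero
  have hbound : ∀ z ∈ closedBall x (‖x‖ / 2), ‖fderiv ℝ newtonKernel z‖ ≤ 1 / (π * ‖x‖ ^ 2) := by
    intro z hz
    have hz' := half_norm_le_of_mem_closedBall hz
    have hzpos : 0 < ‖z‖ := lt_of_lt_of_le (by positivity) hz'
    rw [norm_fderiv_newtonKernel (hz0 z hz)]
    rw [inv_eq_one_div, div_le_div_iff₀ (by positivity) (by positivity), one_mul, one_mul]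
    have hsq : (‖x‖ / 2) ^ 2 ≤ ‖z‖ ^ 2 := pow_le_pow_left₀ (by positivity) hz' 2
    nlinarith [hsq, pi_pos]
  have h := (convex_closedBall x (‖x‖ / 2)).norm_image_sub_le_of_norm_fderiv_le hdiff hbound
    (mem_closedBall_self (by positivity)) (y := x - y) (by
      rw [mem_closedBall, dist_eq_norm, sub_sub_cancel_left, norm_neg]; exact hy)
  rw [sub_sub_cancel_left, norm_neg, Real.norm_eq_abs] at h
  calc |newtonKernel (x - y) - newtonKernel x| ≤ 1 / (π * ‖x‖ ^ 2) * ‖y‖ := h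
    _ = ‖y‖ / (π * ‖x‖ ^ 2) := by ring

/-! ### The far-field expansion of the Newtonian potential, zeroth order -/

/-- Integrability of `y ↦ 1_{B(x, r)}(y) |Γ(x − y)|` and the value of its integral:
`∫_{B(x,r)} |Γ(x − y)| dy = 3|B₁| r² / (8π)`. [folklore] -/
theorem integral_indicator_ball_abs_newtonKernel (x : EuclideanSpace ℝ (Fin 3)) {r : ℝ} (hr : 0 < r) :
    Integrable (fun y ↦ (ball x r).indicator (fun y ↦ |newtonKernel (x - y)|) y) volume ∧
    ∫ y, (ball x r).indicator (fun y ↦ |newtonKernel (x - y)|) y =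
      3 * (volume : Measure (EuclideanSpace ℝ (Fin 3))).real (ball 0 1) * r ^ 2 / (8 * π) := by
  -- `1_{B(x,r)}(y) |Γ(x - y)| = G(x - y)` with `G = 1_{B(0,r)} |Γ|`
  have hG : ∀ y, (ball x r).indicator (fun y ↦ |newtonKernel (x - y)|) y =
      (ball (0 : EuclideanSpace ℝ (Fin 3)) r).indicator (fun z ↦ |newtonKernel z|) (x - y) := by
    intro y
    by_cases hy : y ∈ ball x r
    · have : x - y ∈ ball (0 : EuclideanSpace ℝ (Fin 3)) r := by
        rw [mem_ball_zero_iff, norm_sub_rev]; rwa [mem_ball, dist_eq_norm] at hy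
      rw [indicator_of_mem hy, indicator_of_mem this]
    · have : x - y ∉ ball (0 : EuclideanSpace ℝ (Fin 3)) r := fun h ↦ hy (by
        rw [mem_ball, dist_eq_norm, ← norm_sub_rev]; rwa [mem_ball_zero_iff] at h)
      rw [indicator_of_notMem hy, indicator_of_notMem this]
  have hint0 : IntegrableOn (fun z : EuclideanSpace ℝ (Fin 3) ↦ |newtonKernel z|) (ball 0 r) volume := by
    have h1 : IntegrableOn (fun z : EuclideanSpace ℝ (Fin 3) ↦ (4 * π)⁻¹ * ‖z‖ ^ (-(1 : ℝ))) (ball 0 r) volume :=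
      (NewtonPotentialHolder.integrableOn_ball_norm_rpow_neg (s := 1) (by norm_num) r).const_mul
        (4 * π)⁻¹
    refine h1.congr_fun (fun z _ ↦ ?_) measurableSet_ball
    dsimp only
    rw [abs_newtonKernel, Real.rpow_neg_one]
    ring
  have hintG : Integrable (fun z : EuclideanSpace ℝ (Fin 3) ↦ (ball (0 : EuclideanSpace ℝ (Fin 3)) r).indicator (fun z ↦ |newtonKernel z|) z) :=
    (integrable_indicator_iff measurableSet_ball).2 hint0
  refine ⟨?_, ?_⟩
  · simp_rw [hG]
    exact hintG.comp_sub_left x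
  · simp_rw [hG]
    rw [integral_sub_left_eq_self (fun z ↦ (ball (0 : EuclideanSpace ℝ (Fin 3)) r).indicator (fun z ↦ |newtonKernel z|) z)
      volume x, integral_indicator measurableSet_ball]
    have h2 : ∫ z in ball (0 : EuclideanSpace ℝ (Fin 3)) r, |newtonKernel z| = (4 * π)⁻¹ * ∫ z in ball (0 : EuclideanSpace ℝ (Fin 3)) r, ‖z‖ ^ (-(1 : ℝ)) := by
      rw [← integral_const_mul]
      refine setIntegral_congr_fun measurableSet_ball fun z _ ↦ ?_
      rw [abs_newtonKernel, Real.rpow_neg_one, mul_inv]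
    rw [h2, NewtonPotentialHolder.integral_ball_norm_rpow_neg (by norm_num) hr]
    norm_num
    ring

/-- **Integrability of the Newtonian potential integrand far from the origin**: if `F` is
integrable and `‖y‖⁴ |F(y)| ≤ C₄`, then for `‖x‖ ≥ 4` the function `y ↦ Γ(x − y) F(y)` is integrable
(`|Γ(x − y) F(y)| ≤ C₄ 1_{B(x,1)}(y)|Γ(x − y)| + (4π)⁻¹ |F(y)|`). [folklore] -/
theorem integrable_newtonKernel_sub_mul_of_decay {F : EuclideanSpace ℝ (Fin 3) → ℝ} (hFi : Integrable F volume)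
    {C₄ : ℝ} (hC₄ : ∀ y, ‖y‖ ^ 4 * |F y| ≤ C₄) {x : EuclideanSpace ℝ (Fin 3)} (hx : 4 ≤ ‖x‖) :
    Integrable (fun y ↦ newtonKernel (x - y) * F y) volume := by
  have hC0 : 0 ≤ C₄ := le_trans (by positivity) (hC₄ 0)
  obtain ⟨hI1, -⟩ := integral_indicator_ball_abs_newtonKernel x one_pos
  have hmaj : Integrable (fun y ↦ C₄ * (ball x 1).indicator (fun y ↦ |newtonKernel (x - y)|) y +
      (4 * π)⁻¹ * |F y|) volume := (hI1.const_mul C₄).add (hFi.abs.const_mul _)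
  refine hmaj.mono' ((measurable_newtonKernel.comp (measurable_const.sub measurable_id)).aestronglyMeasurable.mul hFi.1)
    (Eventually.of_forall fun y ↦ ?_)
  rw [Real.norm_eq_abs, abs_mul]
  by_cases hy : y ∈ ball x 1
  · -- near `x`: `‖y‖ ≥ 3`, so `|F y| ≤ C₄`
    have hy3 : 3 ≤ ‖y‖ := by
      rw [mem_ball, dist_eq_norm] at hy
      have := norm_sub_norm_le x y
      have h' : ‖x - y‖ = ‖y - x‖ := norm_sub_rev x y
      linarith
    have hFy : |F y| ≤ C₄ := by
      have h1 : 1 ≤ ‖y‖ ^ 4 := one_le_pow₀ (by linarith)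
      have := hC₄ y
      nlinarith [abs_nonneg (F y)]
    rw [indicator_of_mem hy]
    have h0 : 0 ≤ (4 * π)⁻¹ * |F y| := by positivity
    nlinarith [abs_nonneg (newtonKernel (x - y)), h0]
  · -- far from `x`: `|Γ(x - y)| ≤ (4π)⁻¹`
    rw [indicator_of_notMem hy, mul_zero, zero_add]
    have hxy : 1 ≤ ‖x - y‖ := by
      rw [mem_ball, dist_eq_norm, not_lt, norm_sub_rev] at hy; exact hy
    have hΓ : |newtonKernel (x - y)| ≤ (4 * π)⁻¹ := by
      rw [abs_newtonKernel]
      exact inv_anti₀ (by positivity) (by nlinarith [pi_pos])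
    exact mul_le_mul_of_nonneg_right hΓ (abs_nonneg _)

/-- **Far-field expansion of the Newtonian potential, zeroth order.** Let `F : EuclideanSpace ℝ (Fin 3) → ℝ` be
integrable with `∫ ‖y‖ |F(y)| dy < ∞` (finite first moment) and `‖y‖⁴ |F(y)| ≤ C₄`. Then for
`‖x‖ ≥ 4` the potential `u(x) = ∫ Γ(x − y) F(y) dy` satisfies
`|u(x) − Q Γ(x)| ≤ K ‖x‖⁻²`, `Q = ∫ F`, with `K = (7/(2π)) ∫‖y‖|F| + (3|B₁|/(8π)) C₄` — i.e.
`u = −Q/(4π r) + O(r⁻²)`. (Near region `‖y‖ ≤ ‖x‖/2`: the kernel increment bound; far region: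
`|F| ≤ 16 C₄ ‖x‖⁻⁴` near `x` against `∫_{B(x,‖x‖/4)} |Γ(x − y)| dy = O(‖x‖²)`, and
`|Γ(x − y)| ≤ (π‖x‖)⁻¹` elsewhere against `∫_{‖y‖ > ‖x‖/2} |F| ≤ 2 ‖x‖⁻¹ ∫ ‖y‖|F|`.) This is the
leading term `A/r` of Schoen–Yau's (3.12)–(3.16). [cite: SchoenYauPMT1979, (3.12)–(3.16) (pp. 67–68)] -/
theorem abs_integral_newtonKernel_mul_sub_le {F : EuclideanSpace ℝ (Fin 3) → ℝ} (hFi : Integrable F volume)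
    (hM : Integrable (fun y ↦ ‖y‖ * F y) volume) {C₄ : ℝ} (hC₄ : ∀ y, ‖y‖ ^ 4 * |F y| ≤ C₄)
    {x : EuclideanSpace ℝ (Fin 3)} (hx : 4 ≤ ‖x‖) :
    |(∫ y, newtonKernel (x - y) * F y) - (∫ y, F y) * newtonKernel x| ≤
      ((7 / (2 * π)) * (∫ y, ‖y‖ * |F y|) + (3 * (volume : Measure (EuclideanSpace ℝ (Fin 3))).real (ball 0 1) / (8 * π)) * C₄) *
        ‖x‖⁻¹ ^ 2 := by
  have hx0 : 0 < ‖x‖ := lt_of_lt_of_le (by norm_num) hx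
  have hxne : x ≠ 0 := norm_pos_iff.1 hx0
  have hC0 : 0 ≤ C₄ := le_trans (by positivity) (hC₄ 0)
  set M₁ : ℝ := ∫ y, ‖y‖ * |F y| with hM₁
  have hMi : Integrable (fun y ↦ ‖y‖ * |F y|) volume := by
    refine hM.abs.congr (Eventually.of_forall fun y ↦ ?_)
    simp only [abs_mul, abs_norm]
  have hM₁0 : 0 ≤ M₁ := integral_nonneg fun y ↦ by positivity
  -- the difference as one integral
  have hint := integrable_newtonKernel_sub_mul_of_decay hFi hC₄ hx
  have hdiff : (∫ y, newtonKernel (x - y) * F y) - (∫ y, F y) * newtonKernel x =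
      ∫ y, (newtonKernel (x - y) - newtonKernel x) * F y := by
    rw [← integral_mul_const, ← integral_sub hint (hFi.mul_const _)]
    exact integral_congr_ae (Eventually.of_forall fun y ↦ by ring)
  rw [hdiff]
  -- radius of the ball about `x`
  set r : ℝ := ‖x‖ / 4 with hr
  have hr0 : 0 < r := by positivity
  obtain ⟨hIr, hIrv⟩ := integral_indicator_ball_abs_newtonKernel x hr0
  -- the global majorant
  set g : EuclideanSpace ℝ (Fin 3) → ℝ := fun y ↦ (7 / (2 * π * ‖x‖ ^ 2)) * (‖y‖ * |F y|) +
    16 * C₄ * ‖x‖⁻¹ ^ 4 * (ball x r).indicator (fun y ↦ |newtonKernel (x - y)|) y with hg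
  have hgi : Integrable g volume := (hMi.const_mul _).add (hIr.const_mul _)
  have hptw : ∀ y, ‖(newtonKernel (x - y) - newtonKernel x) * F y‖ ≤ g y := by
    intro y
    rw [Real.norm_eq_abs, abs_mul, hg]
    have hyF0 : 0 ≤ ‖y‖ * |F y| := by positivity
    have hind0 : 0 ≤ (ball x r).indicator (fun y ↦ |newtonKernel (x - y)|) y :=
      Set.indicator_nonneg (fun _ _ ↦ abs_nonneg _) _
    by_cases hyA : ‖y‖ ≤ ‖x‖ / 2
    · -- near region: kernel increment bound
      have h1 := abs_newtonKernel_sub_sub_newtonKernel_le hxne hyA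
      calc |newtonKernel (x - y) - newtonKernel x| * |F y| ≤ ‖y‖ / (π * ‖x‖ ^ 2) * |F y| :=
            mul_le_mul_of_nonneg_right h1 (abs_nonneg _)
        _ = (1 / (π * ‖x‖ ^ 2)) * (‖y‖ * |F y|) := by ring
        _ ≤ (7 / (2 * π * ‖x‖ ^ 2)) * (‖y‖ * |F y|) + 16 * C₄ * ‖x‖⁻¹ ^ 4 *
              (ball x r).indicator (fun y ↦ |newtonKernel (x - y)|) y := by
            have : (1 / (π * ‖x‖ ^ 2)) * (‖y‖ * |F y|) ≤ (7 / (2 * π * ‖x‖ ^ 2)) * (‖y‖ * |F y|) := by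
              apply mul_le_mul_of_nonneg_right _ hyF0
              rw [div_le_div_iff₀ (by positivity) (by positivity)]
              nlinarith [pi_pos, hx0]
            nlinarith [mul_nonneg (mul_nonneg (by norm_num : (0:ℝ) ≤ 16) hC0) (pow_nonneg (inv_nonneg.2 hx0.le) 4)]
    · -- far region: `‖y‖ > ‖x‖/2`, `|F y| ≤ (2‖y‖/‖x‖) |F y|`, `|F y| ≤ 16 C₄ ‖x‖⁻⁴`
      rw [not_le] at hyA
      have hy0 : 0 < ‖y‖ := lt_trans (by positivity) hyA
      have hF1 : |F y| ≤ (2 / ‖x‖) * (‖y‖ * |F y|) := by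
        have : 1 ≤ (2 / ‖x‖) * ‖y‖ := by
          rw [div_mul_eq_mul_div, le_div_iff₀ hx0]; linarith
        nlinarith [abs_nonneg (F y)]
      have hF2 : |F y| ≤ 16 * C₄ * ‖x‖⁻¹ ^ 4 := by
        have h4 : (‖x‖ / 2) ^ 4 ≤ ‖y‖ ^ 4 := by
          exact pow_le_pow_left₀ (by positivity) hyA.le 4
        have := hC₄ y
        have hx4 : (‖x‖ / 2) ^ 4 * |F y| ≤ C₄ := le_trans (mul_le_mul_of_nonneg_right h4 (abs_nonneg _)) this
        have hx4' : ‖x‖ ^ 4 * |F y| ≤ 16 * C₄ := by nlinarith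
        rw [inv_pow, ← div_eq_mul_inv, le_div_iff₀ (by positivity)]
        linarith
      have hΓx : |newtonKernel x| = (4 * π * ‖x‖)⁻¹ := abs_newtonKernel x
      -- the `Γ(x) F(y)` part
      have hpart2 : |newtonKernel x| * |F y| ≤ (1 / (2 * π * ‖x‖ ^ 2)) * (‖y‖ * |F y|) := by
        rw [hΓx]
        calc (4 * π * ‖x‖)⁻¹ * |F y| ≤ (4 * π * ‖x‖)⁻¹ * ((2 / ‖x‖) * (‖y‖ * |F y|)) :=
              mul_le_mul_of_nonneg_left hF1 (by positivity)
          _ = (1 / (2 * π * ‖x‖ ^ 2)) * (‖y‖ * |F y|) := by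
              field_simp
              ring
      -- the `Γ(x - y) F(y)` part
      have hpart1 : |newtonKernel (x - y)| * |F y| ≤ (2 / (π * ‖x‖ ^ 2)) * (‖y‖ * |F y|) +
          16 * C₄ * ‖x‖⁻¹ ^ 4 * (ball x r).indicator (fun y ↦ |newtonKernel (x - y)|) y := by
        by_cases hyB : y ∈ ball x r
        · rw [indicator_of_mem hyB]
          have : |newtonKernel (x - y)| * |F y| ≤ |newtonKernel (x - y)| * (16 * C₄ * ‖x‖⁻¹ ^ 4) :=
            mul_le_mul_of_nonneg_left hF2 (abs_nonneg _)
          have h0 : 0 ≤ (2 / (π * ‖x‖ ^ 2)) * (‖y‖ * |F y|) := by positivity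
          nlinarith
        · rw [indicator_of_notMem hyB, mul_zero, add_zero]
          have hxy : r ≤ ‖x - y‖ := by
            rw [mem_ball, dist_eq_norm, not_lt, norm_sub_rev] at hyB; exact hyB
          have hxy0 : 0 < ‖x - y‖ := lt_of_lt_of_le hr0 hxy
          have hΓ : |newtonKernel (x - y)| ≤ 1 / (π * ‖x‖) := by
            rw [abs_newtonKernel, inv_eq_one_div,
              div_le_div_iff₀ (mul_pos (mul_pos four_pos pi_pos) hxy0) (by positivity), one_mul, one_mul]
            rw [hr] at hxy
            nlinarith [pi_pos]
          calc |newtonKernel (x - y)| * |F y| ≤ (1 / (π * ‖x‖)) * ((2 / ‖x‖) * (‖y‖ * |F y|)) :=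
                mul_le_mul hΓ hF1 (abs_nonneg _) (by positivity)
            _ = (2 / (π * ‖x‖ ^ 2)) * (‖y‖ * |F y|) := by
                field_simp
      calc |newtonKernel (x - y) - newtonKernel x| * |F y|
          ≤ (|newtonKernel (x - y)| + |newtonKernel x|) * |F y| :=
            mul_le_mul_of_nonneg_right (abs_sub _ _) (abs_nonneg _)
        _ = |newtonKernel (x - y)| * |F y| + |newtonKernel x| * |F y| := by ring
        _ ≤ ((2 / (π * ‖x‖ ^ 2)) * (‖y‖ * |F y|) +
              16 * C₄ * ‖x‖⁻¹ ^ 4 * (ball x r).indicator (fun y ↦ |newtonKernel (x - y)|) y) +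
            (1 / (2 * π * ‖x‖ ^ 2)) * (‖y‖ * |F y|) := add_le_add hpart1 hpart2
        _ ≤ _ := by
            have : (2 / (π * ‖x‖ ^ 2)) * (‖y‖ * |F y|) + (1 / (2 * π * ‖x‖ ^ 2)) * (‖y‖ * |F y|) ≤
                (7 / (2 * π * ‖x‖ ^ 2)) * (‖y‖ * |F y|) := by
              rw [← add_mul]
              apply mul_le_mul_of_nonneg_right _ hyF0
              have e1 : (2 / (π * ‖x‖ ^ 2)) + 1 / (2 * π * ‖x‖ ^ 2) = 5 / (2 * π * ‖x‖ ^ 2) := by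
                field_simp
                ring
              rw [e1]
              exact div_le_div_of_nonneg_right (by norm_num) (by positivity)
            linarith
  -- integrate the majorant
  have hle := norm_integral_le_of_norm_le hgi (Eventually.of_forall hptw)
  rw [Real.norm_eq_abs] at hle
  refine hle.trans (le_of_eq ?_)
  rw [hg, integral_add (hMi.const_mul _) (hIr.const_mul _), integral_const_mul, integral_const_mul, hIrv,
    hr]
  field_simp
  ring

end Literature.Analysis.FluidPDE
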